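import Mathlib.Geometry.Manifold.Instances.Sphere
import Mathlib.Geometry.Manifold.Diffeomorph
import Literature.Geometry.Symplectic.SteinDomain
import Literature.Topology.FourManifolds.ClosedBall
import HarnessLib

/-!
# Eliashberg: every Stein filling of the 3-sphere is diffeomorphic to the 4-ball

Topic `Literature/Geometry/Symplectic`; named fact (D-0014) grounding the support item
`Summit.SmoothPoincare4.SmoothPoincare4.Theses.ConvexBisection.SphereSeamStandard`
(stmt-SmoothPoincare4-3548: a homotopy 4-sphere bisected into two compact Stein domains along a
seam homeomorphic to `S³` is `S⁴`) and equally the assembly sketched for route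
SmoothPoincare4/SymplecticCap, crux `SteinSplitV2` (stmt-SmoothPoincare4-0508), whose docstring
asks for "Stein fillings of `(S³, ξ_std)` are `B⁴` [Eliashberg1990 Thm 5.1; McDuff1990 Thm 1.7]
— to enter as a named fact hypothesis".

## The printed result

Eliashberg (1990), *Filling by holomorphic discs and its applications*, Thm. 5.1, in the
one-line form in which the later literature quotes it — Wendl (2010), Introduction (arXiv text
p. 6, read): *"The first uniqueness result of this type was obtained by Eliashberg
[Eliashberg 1990], who showed that all Stein fillings of `S³` are diffeomorphic to the
4-ball."*  (Behind the one-liner: a Stein structure induces on `∂W ≅ S³` a Stein fillable, hence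
tight, contact structure, which is isotopic to the standard one — Eliashberg (1992), Thm. 2.1.1 —
and a Stein filling is minimal, so Thm. 5.1 of the 1990 paper (symplectic fillings of the
standard `S³` are blow-ups of `B⁴`; McDuff (1990), Thm. 1.7, p. 683, read: *"If `p ≠ 4`, minimal
fillings `(Z, ω)` of `(L_p, σ)` are unique up to diffeomorphism"*, `L₁ = S³`) gives `W ≅ B⁴`.)
The primary source (LMS Lecture Note Ser. 151) is not held; the theorem number is the one used
throughout the tree (`GromovR4.lean`, route files) and by McDuff (1990).

## Lean rendering

* "Stein filling `W`": a compact `C^∞` 4-manifold with boundary (model `𝓡∂ 4`), Hausdorff and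
  second countable, admitting a Stein structure in the sense of the tree,
  `Literature.Geometry.Symplectic.IsSteinDomain W` (`SteinDomain.lean`: integrable `J`,
  strictly `J`-convex `φ` with `∂W` its regular maximal level set — Eliashberg's / Gompf's
  compact Stein domain).
* "of `S³`": SOME boundary datum of `W` (the boundary `∂W` as an abstract smooth 3-manifold with
  its embedding, `Literature.Topology.FourManifolds.BoundaryData (𝓡∂ 4) W (𝓡 3)`; all boundary
  data are diffeomorphic over `W`, `BoundaryData.nonempty_diffeomorph`, so "some" is "any") has
  carrier DIFFEOMORPHIC to Mathlib's round `S³ ⊂ ℝ⁴` — exactly the printed hypothesis; users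
  holding only a homeomorphism `∂W ≃ₜ S³` (as in stmt-SmoothPoincare4-3548) need smoothing
  uniqueness in dimension 3 (Moise/Munkres) first, which is NOT part of this fact.
* "diffeomorphic to the 4-ball": `Nonempty (W ≃ₘ⟮𝓡∂ 4, 𝓡∂ 4⟯ 𝔻⁴)` for the tree's closed unit
  ball `Metric.closedBall (0 : ℝ⁴) 1` with its `𝓡∂ 4` structure (`ClosedBall.lean`,
  `instChartedSpaceClosedBall`, `instIsManifoldClosedBall`).

Nothing is asserted: the fact is a `def … : Prop` taken as a hypothesis `(h : …)`; two
consequence lemmas used by the routes are proved from it.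

## References

* Ya. Eliashberg, *Filling by holomorphic discs and its applications*, in: Geometry of
  Low-Dimensional Manifolds 2, LMS Lecture Note Ser. 151, CUP (1990), 45–67, Thm. 5.1.
  [Eliashberg1990]
* C. Wendl, *Strongly fillable contact manifolds and `J`-holomorphic foliations*, Duke Math. J.
  151 (2010), 337–384 (arXiv:0806.3193), Introduction, p. 6 of the arXiv text. [Wendl2010]
* Ya. Eliashberg, *Contact 3-manifolds twenty years since J. Martinet's work*, Ann. Inst.
  Fourier 42 (1992), 165–192, Thm. 2.1.1. [Eliashberg1992]
* D. McDuff, *The structure of rational and ruled symplectic 4-manifolds*, J. Amer. Math. Soc.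
  3 (1990), 679–712, Thm. 1.7 (p. 683). [McDuff1990]
-/

noncomputable section

open scoped Manifold ContDiff

namespace Literature.Geometry.Symplectic

/-- Local notation for the model space `ℝ⁴ = EuclideanSpace ℝ (Fin 4)`. -/
local notation "E4" => EuclideanSpace ℝ (Fin 4)

/-- **Eliashberg (1990): all Stein fillings of `S³` are diffeomorphic to the 4-ball** (as quoted
by Wendl 2010, Introduction p. 6; Eliashberg 1990, Thm. 5.1 with Eliashberg 1992, Thm. 2.1.1).
A compact, Hausdorff, second countable `C^∞` 4-manifold with boundary `W` which admits a Stein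
structure (`IsSteinDomain W`) and whose boundary 3-manifold (some boundary datum) is
diffeomorphic to the round `S³` is diffeomorphic to the closed unit ball `𝔻⁴ ⊂ ℝ⁴`.
Grounds `Summit.SmoothPoincare4.SmoothPoincare4.Theses.ConvexBisection.SphereSeamStandard`
(with Moise smoothing of the seam and Cerf's `Γ₄ = 0`) and the assembly of
`Summit.SmoothPoincare4.SmoothPoincare4.Theses.SymplecticCap.SteinSplitV2`.
[cite: Eliashberg1990, Thm. 5.1] [cite: Wendl2010, Introduction p. 6] -/
def Eliashberg1990_steinFilling_sphere_three : Prop :=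
  ∀ (W : Type) [TopologicalSpace W] [T2Space W] [SecondCountableTopology W]
    [ChartedSpace (EuclideanHalfSpace 4) W] [IsManifold (𝓡∂ 4) ∞ W] [CompactSpace W],
    IsSteinDomain W →
    (∃ b : Literature.Topology.FourManifolds.BoundaryData (𝓡∂ 4) W (𝓡 3),
        Nonempty (b.carrier ≃ₘ⟮𝓡 3, 𝓡 3⟯ (Metric.sphere (0 : E4) 1))) →
    Nonempty (W ≃ₘ⟮𝓡∂ 4, 𝓡∂ 4⟯ (Metric.closedBall (0 : E4) 1))

/-- The fact applied to a given Stein structure (rather than mere existence of one): a Stein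
domain `(W, S)` whose boundary is diffeomorphic to `S³` is diffeomorphic to `𝔻⁴`. [folklore] -/
theorem Eliashberg1990_steinFilling_sphere_three.of_steinStructure
    (h : Eliashberg1990_steinFilling_sphere_three) {W : Type} [TopologicalSpace W] [T2Space W]
    [SecondCountableTopology W] [ChartedSpace (EuclideanHalfSpace 4) W] [IsManifold (𝓡∂ 4) ∞ W]
    [CompactSpace W] (S : SteinStructure W)
    (b : Literature.Topology.FourManifolds.BoundaryData (𝓡∂ 4) W (𝓡 3))
    (e : b.carrier ≃ₘ⟮𝓡 3, 𝓡 3⟯ (Metric.sphere (0 : E4) 1)) :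
    Nonempty (W ≃ₘ⟮𝓡∂ 4, 𝓡∂ 4⟯ (Metric.closedBall (0 : E4) 1)) :=
  h W ⟨S⟩ ⟨b, ⟨e⟩⟩

/-- Under the fact, a Stein filling of `S³` is in particular HOMEOMORPHIC to the closed 4-ball
(forget smoothness; the form consumed together with purely topological gluing lemmas).
[folklore] -/
theorem Eliashberg1990_steinFilling_sphere_three.homeomorphic
    (h : Eliashberg1990_steinFilling_sphere_three) (W : Type) [TopologicalSpace W] [T2Space W]
    [SecondCountableTopology W] [ChartedSpace (EuclideanHalfSpace 4) W] [IsManifold (𝓡∂ 4) ∞ W]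
    [CompactSpace W] (hS : IsSteinDomain W)
    (hb : ∃ b : Literature.Topology.FourManifolds.BoundaryData (𝓡∂ 4) W (𝓡 3),
        Nonempty (b.carrier ≃ₘ⟮𝓡 3, 𝓡 3⟯ (Metric.sphere (0 : E4) 1))) :
    Nonempty (W ≃ₜ (Metric.closedBall (0 : E4) 1)) :=
  (h W hS hb).map fun Φ => Φ.toHomeomorph

end Literature.Geometry.Symplectic

end
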